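import Summits.QuantumFields.BalabanUV.T4Continuum.Support.NE7DcurlGaugeCovariance
import Summits.QuantumFields.BalabanUV.T4Continuum.Support.NE7CubicVertexLetters
import Summits.QuantumFields.BalabanUV.T4Continuum.Support.NE7DcurlBaseLipschitz
import Summits.QuantumFields.BalabanUV.T4Continuum.Support.NE3CurlStability
import HarnessLib

/-!
# NE7CubicVertexCurved — THE CURVED TWIN OF F46: the COVARIANT adjacent differences of the cubic vertex `𝒬_W(A) = dcurlAt W A A` at a small-field background,
# in exactly the transported form F61's by-parts letter asks, are `≤ 64α₀α₁ + 1024·x·α₀²` — `α₀ = ‖A‖_∞`, `α₁` = the backward COVARIANT differences of `A`,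
# `x` = the plaquette radius of `W`; NO local gauge construction: the regauging is the explicit global `u(y) = W(y − e_τ, τ)⁻¹`

Cell `pub-balaban`, rung (B)+1 sub-cell t4, lineage `b2b-balaban-t4-ne7-p1` (CRUX PROVER NE7 #1 = OWNER of row NE7), generation 75.  File F63 — second brick of the STRONG
curved expansion letter (memo `t4/b2b-balaban-t4-ne7-p1-g75/CURVED-APE-ROAD.md` (L5)) — over F62 `NE7DcurlGaugeCovariance` (gauge + translation covariance of
`dcurlAt`), F46 `NE7CubicVertexLetters` ∕ row NE3's `NE3HessContinuity.norm_dcurlAt_le` (size), F47 `NE7DcurlBaseLipschitz.norm_dcurlAt_sub_dcurlAt_le` (base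
Lipschitz on three links), `NE3CurlStability.norm_Ad_sub_Ad_le`, `B7Prop1Local.hol_plaqWord_eq`.

THE DEVICE.  The plaquette `p′ = p − e_τ` read at `p`: by translation covariance `𝒬_W(A)(z − e_τ) = 𝒬_{W′}(A′)(z)` (`W′ = W(· − e_τ)`, `A′ = A(· − e_τ)`), and by GAUGE
covariance with the explicit `u(y) := W(y − e_τ, τ)⁻¹`: `Ad_{u(z)} 𝒬_{W′}(A′)(z) = 𝒬_{W′^u}(A′^u)(z)` where `W′^u(y,κ) = W(y−e_τ,τ)⁻¹W(y−e_τ,κ)W(y+e_κ−e_τ,τ) =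
Ad(plaquette)·W(y,κ)` is within `x` of `W(y,κ)` on every bond (EQUAL to it for `κ = τ`), and `A′^u(y,κ) = Ad_{W(y+e_κ−e_τ,τ)⁻¹}A(y−e_τ,κ)` is within the backward
covariant difference `α₁` of `A(y,κ)`.  Hence `𝒬_W(A)(z) − Ad_{u(z)}𝒬_W(A)(z − e_τ) = [bilinearity in A − A′^u: 64α₀α₁] + [base W vs W′^u on three links: 960xα₀²]`
(CORE), and F61's two transports differ from `Ad_{u(z)}` by the conjugation with ONE plaquette variable of `W` (`2x·‖𝒬‖ ≤ 64xα₀²`).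

WHAT ([folklore] lattice calculus; 0 def, 0 sorry; `W` unitary with `SmallField W x`; `A` with `‖A‖ ≤ α₀` and backward covariant differences `≤ α₁`):
§1 `gaugeAct_shift_link_eq` ∕ `norm_gaugeAct_shift_link_sub_le` (the regauged shifted background vs `W`: equal on `τ`-bonds, within `x` elsewhere),
   `norm_dirGauge_shift_sub_le` (the regauged shifted direction vs `A`: within `α₁`).
§2 **`norm_dcurlAt_self_sub_Ad_shift_le`** (CORE): `‖𝒬_W(A)(z;μ,ν) − Ad_{W(z−e_τ,τ)⁻¹} 𝒬_W(A)(z−e_τ;μ,ν)‖ ≤ 64α₀α₁ + 960xα₀²`.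
§3 **`norm_cubicVertex_covDiff₁_le`**, **`norm_cubicVertex_covDiff₂_le`** — F61's hypotheses `hG₁`, `hG₂` for `G := 𝒬_W(A)` with `γ = 64α₀α₁ + 1024xα₀²`.
CURRENCY: `α₀ = α̂∕M`, `α₁ = α̂₁∕M²` ((1.36)-gradient member), `x = b∕M²` ⇒ `γ = O(M⁻³)` — the closing currency (F46's flat `64α̂α̂₁M⁻³` plus curvature junk `O(bα̂²M⁻⁴)`).
HONEST FRAMING (page 1): lattice calculus on OUR objects; the gradient letter `α₁` of the Landau representative is a HYPOTHESIS ([B8] (1.36)₂ TYPE — not the sup member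
E′ delivers); nothing of Bałaban's asserted; the strong hEXP assembly (curved F48b) and (APE) on curved data NOT proved; NOT ONE-STEP, NOT NE7; spine 0∕9; finite T⁴
rung (B)+1 — NOT infinite volume, NOT mass gap, NOT `BetaPertH`, NOT Clay.  Continuum YM on T⁴ ⇐ BetaPertH ∧ nine spine estimates (0/9 proved); BetaPertH ⇐ (D1) ∧
(D4) ∧ CAP+tail; G-an2-4 gates asym, D1 and NE2/3/4.
-/

set_option autoImplicit false

open scoped BigOperators Matrix.Norms.L2Operator
open NormedSpace Finset Set

namespace Summit.QuantumFields.BalabanUV.T4Continuum.NE7CubicVertexCurved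

open Literature.MathematicalPhysics.QuantumFieldTheory.Balaban1983to89
open B7Prop1Explicit B7Prop2Explicit B7Prop1Local MatrixLog UnitaryModel
open T4AveragingDeficitWall (Ad IsUnitaryCfg SmallField curlAt)
open T4AveragingDeficitNonAbelian (Ad_mul Ad_sub)
open AveragingDeficitTransport (norm_Ad_of_unitary mem_U1_of_unitary)
open AveragingDeficitNearIdentity (Ad_one)
open AveragingDeficitLocality (dirGauge)
open AveragingDeficitKDatum (isUnitaryCfg_gaugeAct)
open NE3EnergyShapes (IsUnitarySite)
open NE3HessForm (dcurlAt)
open NE3HessContinuity (bondL1At bondL1At_nonneg norm_dcurlAt_le)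
open NE3EnergyHessBilin (dcurlAt_add_left dcurlAt_add_right)
open NE3CurlStability (norm_Ad_sub_Ad_le)
open NE7CubicVertexLetters (bondL1At_le_of_sup)
open NE7DcurlBaseLipschitz (norm_dcurlAt_sub_dcurlAt_le)
open NE7DcurlGaugeCovariance (dcurlAt_gaugeAct dcurlAt_shift)

noncomputable section

variable {d : ℕ} {n : Type*} [Fintype n] [DecidableEq n]

/-! ## §1 The regauged shifted background and direction -/

/-- The regauged shifted background, spelled: `(W(·−e_τ))^{u}(y,κ) = W(y−e_τ,τ)⁻¹·W(y−e_τ,κ)·W(y+e_κ−e_τ,τ)` for `u(y) = W(y−e_τ,τ)⁻¹`. [folklore] -/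
theorem gaugeAct_shift_eq (W : Site d → Fin d → (Matrix n n ℂ)ˣ) (τ : Fin d) (y : Site d) (κ : Fin d) :
    gaugeAct (fun y => (W (y - e τ) τ)⁻¹) (fun y κ => W (y - e τ) κ) y κ = (W (y - e τ) τ)⁻¹ * W (y - e τ) κ * W (y + e κ - e τ) τ := by
  simp only [gaugeAct, inv_inv]

/-- On `τ`-bonds the regauged shifted background IS `W`: `(W′)^{u}(y,τ) = W(y,τ)`. [folklore] -/
theorem gaugeAct_shift_link_eq (W : Site d → Fin d → (Matrix n n ℂ)ˣ) (τ : Fin d) (y : Site d) :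
    gaugeAct (fun y => (W (y - e τ) τ)⁻¹) (fun y κ => W (y - e τ) κ) y τ = W y τ := by
  rw [gaugeAct_shift_eq, inv_mul_cancel, one_mul, add_sub_cancel_right]

/-- On the other bonds it is `W` conjugated by a plaquette variable: `(W′)^{u}(y,κ) = Ad_{W(y−e_τ,τ)⁻¹}(W(∂p(y−e_τ; κ,τ)))·W(y,κ)` (as units). [folklore] -/
theorem gaugeAct_shift_link_eq_hol (W : Site d → Fin d → (Matrix n n ℂ)ˣ) (τ : Fin d) (y : Site d) (κ : Fin d) :
    gaugeAct (fun y => (W (y - e τ) τ)⁻¹) (fun y κ => W (y - e τ) κ) y κ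
      = (W (y - e τ) τ)⁻¹ * hol W (y - e τ) (plaqWord κ τ) * W (y - e τ) τ * W y κ := by
  rw [gaugeAct_shift_eq, hol_plaqWord_eq]
  have h1 : y - e τ + e κ = y + e κ - e τ := by abel
  have h2 : y - e τ + e τ = y := by abel
  rw [h1, h2]
  group

/-- **THE REGAUGED SHIFTED BACKGROUND IS WITHIN THE PLAQUETTE RADIUS OF `W`** on every bond: `‖(W′)^{u}(y,κ) − W(y,κ)‖ ≤ x` for unitary `W` with
`SmallField W x` (`κ ≠ τ`: one plaquette variable; `κ = τ`: equality). [folklore] -/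
theorem norm_gaugeAct_shift_link_sub_le [Nonempty n] {W : Site d → Fin d → (Matrix n n ℂ)ˣ} (hW : IsUnitaryCfg W) {x : ℝ} (hx : 0 ≤ x)
    (hWx : SmallField W x) (τ : Fin d) (y : Site d) (κ : Fin d) :
    ‖((gaugeAct (fun y => (W (y - e τ) τ)⁻¹) (fun y κ => W (y - e τ) κ) y κ : (Matrix n n ℂ)ˣ) : Matrix n n ℂ) - (W y κ : Matrix n n ℂ)‖ ≤ x := by
  by_cases hκ : κ = τ
  · subst hκ
    rw [gaugeAct_shift_link_eq, sub_self, norm_zero]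
    exact hx
  · rw [gaugeAct_shift_link_eq_hol]
    set v : (Matrix n n ℂ)ˣ := W (y - e τ) τ with hv
    set h : (Matrix n n ℂ)ˣ := hol W (y - e τ) (plaqWord κ τ) with hh
    have hsplit : ((v⁻¹ * h * v * W y κ : (Matrix n n ℂ)ˣ) : Matrix n n ℂ) - (W y κ : Matrix n n ℂ)
        = Ad v⁻¹ ((h : Matrix n n ℂ) - 1) * (W y κ : Matrix n n ℂ) := by
      simp only [Ad, inv_inv, Units.val_mul, mul_sub, sub_mul, mul_one, Units.inv_mul, one_mul]
    rw [hsplit]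
    have hWn : ‖((W y κ : (Matrix n n ℂ)ˣ) : Matrix n n ℂ)‖ ≤ 1 := (mem_U1_of_unitary (hW y κ)).1
    have hvu : v⁻¹ ∈ unitaryUnits (Matrix n n ℂ) := (unitaryUnits _).inv_mem (hW _ _)
    calc ‖Ad v⁻¹ ((h : Matrix n n ℂ) - 1) * (W y κ : Matrix n n ℂ)‖ ≤ ‖Ad v⁻¹ ((h : Matrix n n ℂ) - 1)‖ * ‖((W y κ : (Matrix n n ℂ)ˣ) : Matrix n n ℂ)‖ :=
          norm_mul_le _ _
      _ ≤ x * 1 := by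
          rw [norm_Ad_of_unitary hvu]
          exact mul_le_mul (hWx (y - e τ) κ τ hκ) hWn (norm_nonneg _) hx
      _ = x := mul_one x

/-- The regauged shifted direction, spelled: `(A′)^{u}(y,κ) = Ad_{W(y+e_κ−e_τ,τ)⁻¹} A(y−e_τ,κ)`. [folklore] -/
theorem dirGauge_shift_eq (W : Site d → Fin d → (Matrix n n ℂ)ˣ) (A : Site d → Fin d → Matrix n n ℂ) (τ : Fin d) (y : Site d) (κ : Fin d) :
    dirGauge (fun y => (W (y - e τ) τ)⁻¹) (fun y κ => A (y - e τ) κ) y κ = Ad (W (y + e κ - e τ) τ)⁻¹ (A (y - e τ) κ) := rfl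

/-! ## §2 CORE: the cubic vertex against its regauged shift -/

/-- **CORE**: for unitary `W` with `SmallField W x` (`x ≥ 0`), `‖A‖ ≤ α₀` and backward covariant differences `‖A(y,κ) − Ad_{W(y+e_κ−e_τ,τ)⁻¹}A(y−e_τ,κ)‖ ≤ α₁`:
`‖𝒬_W(A)(z;μ,ν) − Ad_{W(z−e_τ,τ)⁻¹} 𝒬_W(A)(z−e_τ;μ,ν)‖ ≤ 64α₀α₁ + 960·x·α₀²`. [folklore] -/
theorem norm_dcurlAt_self_sub_Ad_shift_le [Nonempty n] {W : Site d → Fin d → (Matrix n n ℂ)ˣ} (hW : IsUnitaryCfg W) {x : ℝ} (hx : 0 ≤ x)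
    (hWx : SmallField W x) {A : Site d → Fin d → Matrix n n ℂ} {α₀ α₁ : ℝ} (hA : ∀ y κ, ‖A y κ‖ ≤ α₀)
    (hA1 : ∀ (y : Site d) (κ τ : Fin d), ‖A y κ - Ad (W (y + e κ - e τ) τ)⁻¹ (A (y - e τ) κ)‖ ≤ α₁) (z : Site d) (μ ν τ : Fin d) :
    ‖dcurlAt W A A z μ ν - Ad (W (z - e τ) τ)⁻¹ (dcurlAt W A A (z - e τ) μ ν)‖ ≤ 64 * α₀ * α₁ + 960 * x * α₀ ^ 2 := by
  have hα : 0 ≤ α₀ := (norm_nonneg _).trans (hA z μ)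
  have hα1 : 0 ≤ α₁ := (norm_nonneg _).trans (hA1 z μ τ)
  -- the regauging data
  set u : Site d → (Matrix n n ℂ)ˣ := fun y => (W (y - e τ) τ)⁻¹ with hu
  set W' : Site d → Fin d → (Matrix n n ℂ)ˣ := fun y κ => W (y - e τ) κ with hW'
  set A' : Site d → Fin d → Matrix n n ℂ := fun y κ => A (y - e τ) κ with hA'
  have huU : ∀ y, u y ∈ unitaryUnits (Matrix n n ℂ) := fun y => (unitaryUnits _).inv_mem (hW _ _)
  have hW'u : IsUnitaryCfg W' := fun y κ => hW _ _
  -- translation then gauge covariance: `Ad_{u z} 𝒬_W(A)(z − e_τ) = 𝒬_{W′^u}(A′^u)(z)`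
  have hshift : dcurlAt W A A (z - e τ) μ ν = dcurlAt W' A' A' z μ ν := (dcurlAt_shift W A A (e τ) z μ ν).symm
  have hgauge : Ad (u z) (dcurlAt W' A' A' z μ ν) = dcurlAt (gaugeAct u W') (dirGauge u A') (dirGauge u A') z μ ν :=
    (dcurlAt_gaugeAct u W' A' A' z μ ν).symm
  set Wt := gaugeAct u W' with hWt
  set At := dirGauge u A' with hAt
  have hWtu : IsUnitaryCfg Wt := isUnitaryCfg_gaugeAct huU hW'u
  -- letters of `At`: sup `α₀`, distance to `A` `α₁`
  have hAt0 : ∀ y κ, ‖At y κ‖ ≤ α₀ := fun y κ => by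
    rw [hAt, dirGauge_shift_eq, norm_Ad_of_unitary ((unitaryUnits _).inv_mem (hW _ _))]
    exact hA _ _
  set D : Site d → Fin d → Matrix n n ℂ := fun y κ => A y κ - At y κ with hD
  have hD1 : ∀ y κ, ‖D y κ‖ ≤ α₁ := fun y κ => by
    simp only [hD, hAt]
    exact hA1 y κ τ
  -- letters of `Wt`: within `x` of `W` on every bond
  have hlink : ∀ y κ, ‖((Wt y κ : (Matrix n n ℂ)ˣ) : Matrix n n ℂ) - (W y κ : Matrix n n ℂ)‖ ≤ x := fun y κ =>
    norm_gaugeAct_shift_link_sub_le hW hx hWx τ y κ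
  -- the target, rewritten
  have hid : dcurlAt W A A z μ ν - Ad (W (z - e τ) τ)⁻¹ (dcurlAt W A A (z - e τ) μ ν)
      = (dcurlAt W A A z μ ν - dcurlAt W At At z μ ν) + (dcurlAt W At At z μ ν - dcurlAt Wt At At z μ ν) := by
    rw [hshift, show (W (z - e τ) τ)⁻¹ = u z from rfl, hgauge]; abel
  rw [hid]
  -- bilinearity: `𝒬_W(A) − 𝒬_W(At) = dcurlAt W D A + dcurlAt W At D`
  have hAD : A = At + D := by funext y κ; simp [hD]
  have hbil : dcurlAt W A A z μ ν - dcurlAt W At At z μ ν = dcurlAt W D A z μ ν + dcurlAt W At D z μ ν := by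
    have e1 : dcurlAt W A A z μ ν = dcurlAt W At A z μ ν + dcurlAt W D A z μ ν := by
      conv_lhs => rw [hAD]
      rw [dcurlAt_add_left, ← hAD]
    have e2 : dcurlAt W At A z μ ν = dcurlAt W At At z μ ν + dcurlAt W At D z μ ν := by
      conv_lhs => rw [hAD]
      rw [dcurlAt_add_right]
    rw [e1, e2]; abel
  have hbD := bondL1At_le_of_sup hD1 z μ ν
  have hbA := bondL1At_le_of_sup hA z μ ν
  have hbAt := bondL1At_le_of_sup hAt0 z μ ν
  have hbD0 := bondL1At_nonneg D z μ ν
  have hbA0 := bondL1At_nonneg A z μ ν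
  have hbAt0 := bondL1At_nonneg At z μ ν
  have hfirst : ‖dcurlAt W A A z μ ν - dcurlAt W At At z μ ν‖ ≤ 64 * α₀ * α₁ := by
    rw [hbil]
    calc ‖dcurlAt W D A z μ ν + dcurlAt W At D z μ ν‖ ≤ ‖dcurlAt W D A z μ ν‖ + ‖dcurlAt W At D z μ ν‖ := norm_add_le _ _
      _ ≤ 2 * (bondL1At D z μ ν * bondL1At A z μ ν) + 2 * (bondL1At At z μ ν * bondL1At D z μ ν) :=
          add_le_add (norm_dcurlAt_le hW D A z μ ν) (norm_dcurlAt_le hW At D z μ ν)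
      _ ≤ 2 * ((4 * α₁) * (4 * α₀)) + 2 * ((4 * α₀) * (4 * α₁)) := by
          have h1 := mul_le_mul hbD hbA hbA0 (by positivity)
          have h2 := mul_le_mul hbAt hbD hbD0 (by positivity)
          linarith
      _ = 64 * α₀ * α₁ := by ring
  have hsecond : ‖dcurlAt W At At z μ ν - dcurlAt Wt At At z μ ν‖ ≤ 960 * x * α₀ ^ 2 := by
    rw [norm_sub_rev]
    have h := norm_dcurlAt_sub_dcurlAt_le hW hWtu At At z μ ν (hlink z μ) (hlink (z + e μ) ν) (hlink (z + e ν) μ)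
    refine h.trans ?_
    have hsq : bondL1At At z μ ν * bondL1At At z μ ν ≤ (4 * α₀) * (4 * α₀) := mul_le_mul hbAt hbAt hbAt0 (by positivity)
    nlinarith
  exact (norm_add_le _ _).trans (by linarith)

/-! ## §3 F61's two transported differences for `G := 𝒬_W(A)` -/

/-- `‖𝒬_W(A)(p′)‖ ≤ 32α₀²` at any unitary background. [folklore] -/
theorem norm_dcurlAt_self_le [Nonempty n] {W : Site d → Fin d → (Matrix n n ℂ)ˣ} (hW : IsUnitaryCfg W) {A : Site d → Fin d → Matrix n n ℂ} {α₀ : ℝ}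
    (hA : ∀ y κ, ‖A y κ‖ ≤ α₀) (z : Site d) (μ ν : Fin d) : ‖dcurlAt W A A z μ ν‖ ≤ 32 * α₀ ^ 2 := by
  have h := norm_dcurlAt_le hW A A z μ ν
  have hb := bondL1At_le_of_sup hA z μ ν
  have hb0 := bondL1At_nonneg A z μ ν
  have hsq : bondL1At A z μ ν * bondL1At A z μ ν ≤ (4 * α₀) * (4 * α₀) := mul_le_mul hb hb hb0 ((norm_nonneg _).trans (hA z μ) |> fun h => by positivity)
  nlinarith

/-- Conjugation by a plaquette variable of `W` moves `𝒬` by at most `2x·‖𝒬‖ ≤ 64xα₀²`. [folklore] -/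
theorem norm_Ad_hol_dcurlAt_sub_le [Nonempty n] {W : Site d → Fin d → (Matrix n n ℂ)ˣ} (hW : IsUnitaryCfg W) {x : ℝ} (hWx : SmallField W x)
    {A : Site d → Fin d → Matrix n n ℂ} {α₀ : ℝ} (hA : ∀ y κ, ‖A y κ‖ ≤ α₀) (y : Site d) {κ κ' : Fin d} (hκ : κ ≠ κ')
    (z : Site d) (μ ν : Fin d) :
    ‖Ad (hol W y (plaqWord κ κ')) (dcurlAt W A A z μ ν) - dcurlAt W A A z μ ν‖ ≤ 64 * x * α₀ ^ 2 := by
  have hh : hol W y (plaqWord κ κ') ∈ unitaryUnits (Matrix n n ℂ) := hol_mem_of (S := unitaryUnits (Matrix n n ℂ)) (fun x κ => hW x κ) y _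
  have h1 := norm_Ad_sub_Ad_le ((unitaryUnits (Matrix n n ℂ)).one_mem) hh (dcurlAt W A A z μ ν)
  rw [Ad_one] at h1
  have hx : 0 ≤ x := (norm_nonneg _).trans (hWx y κ κ' hκ)
  have hQ := norm_dcurlAt_self_le hW hA z μ ν
  calc _ ≤ 2 * ‖((hol W y (plaqWord κ κ') : (Matrix n n ℂ)ˣ) : Matrix n n ℂ) - ((1 : (Matrix n n ℂ)ˣ) : Matrix n n ℂ)‖ * ‖dcurlAt W A A z μ ν‖ := h1
    _ ≤ 2 * x * (32 * α₀ ^ 2) := by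
        rw [Units.val_one]
        exact mul_le_mul (mul_le_mul_of_nonneg_left (hWx y κ κ' hκ) (by norm_num)) hQ (norm_nonneg _) (by positivity)
    _ = 64 * x * α₀ ^ 2 := by ring

/-- **F61's `hG₁` FOR THE CUBIC VERTEX** (the `ν`-difference seen from the bond `(z,μ)`, `μ ≠ ν`):
`‖Ad_{W(z,μ)⁻¹}𝒬(z) − Ad_{(W(z−e_ν,μ)W(z−e_ν+e_μ,ν))⁻¹}𝒬(z−e_ν)‖ ≤ 64α₀α₁ + 1024xα₀²`. [folklore] -/
theorem norm_cubicVertex_covDiff₁_le [Nonempty n] {W : Site d → Fin d → (Matrix n n ℂ)ˣ} (hW : IsUnitaryCfg W) {x : ℝ} (hx : 0 ≤ x)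
    (hWx : SmallField W x) {A : Site d → Fin d → Matrix n n ℂ} {α₀ α₁ : ℝ} (hA : ∀ y κ, ‖A y κ‖ ≤ α₀)
    (hA1 : ∀ (y : Site d) (κ τ : Fin d), ‖A y κ - Ad (W (y + e κ - e τ) τ)⁻¹ (A (y - e τ) κ)‖ ≤ α₁) (z : Site d) {μ ν : Fin d} (hμν : μ ≠ ν) :
    ‖Ad (W z μ)⁻¹ (dcurlAt W A A z μ ν) - Ad (W (z - e ν) μ * W (z - e ν + e μ) ν)⁻¹ (dcurlAt W A A (z - e ν) μ ν)‖
      ≤ 64 * α₀ * α₁ + 1024 * x * α₀ ^ 2 := by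
  -- the transport from `p − e_ν` to the bond frame is `W(z,μ)⁻¹ · u(z) · (plaquette)`
  have hT : (W (z - e ν) μ * W (z - e ν + e μ) ν)⁻¹ = (W z μ)⁻¹ * ((W (z - e ν) ν)⁻¹ * hol W (z - e ν) (plaqWord ν μ)) := by
    rw [hol_plaqWord_eq]
    have h1 : z - e ν + e ν = z := by abel
    rw [h1]
    group
  rw [hT, Ad_mul, ← Ad_sub, norm_Ad_of_unitary ((unitaryUnits _).inv_mem (hW z μ)), Ad_mul]
  have hcore := norm_dcurlAt_self_sub_Ad_shift_le hW hx hWx hA hA1 z μ ν ν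
  have hhol := norm_Ad_hol_dcurlAt_sub_le hW hWx hA (z - e ν) hμν.symm (z - e ν) μ ν
  have hsplit : dcurlAt W A A z μ ν - Ad (W (z - e ν) ν)⁻¹ (Ad (hol W (z - e ν) (plaqWord ν μ)) (dcurlAt W A A (z - e ν) μ ν))
      = (dcurlAt W A A z μ ν - Ad (W (z - e ν) ν)⁻¹ (dcurlAt W A A (z - e ν) μ ν))
        - Ad (W (z - e ν) ν)⁻¹ (Ad (hol W (z - e ν) (plaqWord ν μ)) (dcurlAt W A A (z - e ν) μ ν) - dcurlAt W A A (z - e ν) μ ν) := by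
    rw [Ad_sub]; abel
  rw [hsplit]
  calc _ ≤ ‖dcurlAt W A A z μ ν - Ad (W (z - e ν) ν)⁻¹ (dcurlAt W A A (z - e ν) μ ν)‖
        + ‖Ad (W (z - e ν) ν)⁻¹ (Ad (hol W (z - e ν) (plaqWord ν μ)) (dcurlAt W A A (z - e ν) μ ν) - dcurlAt W A A (z - e ν) μ ν)‖ := norm_sub_le _ _
    _ ≤ (64 * α₀ * α₁ + 960 * x * α₀ ^ 2) + 64 * x * α₀ ^ 2 := by
        rw [norm_Ad_of_unitary ((unitaryUnits _).inv_mem (hW _ _))]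
        exact add_le_add hcore hhol
    _ = 64 * α₀ * α₁ + 1024 * x * α₀ ^ 2 := by ring

/-- **F61's `hG₂` FOR THE CUBIC VERTEX** (the `μ`-difference seen from the bond `(z,ν)`, `μ ≠ ν`):
`‖Ad_{(W(z−e_μ,μ)W(z,ν))⁻¹}𝒬(z−e_μ) − Ad_{(W(z,μ)W(z+e_μ,ν)W(z+e_ν,μ)⁻¹)⁻¹}𝒬(z)‖ ≤ 64α₀α₁ + 1024xα₀²`. [folklore] -/
theorem norm_cubicVertex_covDiff₂_le [Nonempty n] {W : Site d → Fin d → (Matrix n n ℂ)ˣ} (hW : IsUnitaryCfg W) {x : ℝ} (hx : 0 ≤ x)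
    (hWx : SmallField W x) {A : Site d → Fin d → Matrix n n ℂ} {α₀ α₁ : ℝ} (hA : ∀ y κ, ‖A y κ‖ ≤ α₀)
    (hA1 : ∀ (y : Site d) (κ τ : Fin d), ‖A y κ - Ad (W (y + e κ - e τ) τ)⁻¹ (A (y - e τ) κ)‖ ≤ α₁) (z : Site d) {μ ν : Fin d} (hμν : μ ≠ ν) :
    ‖Ad (W (z - e μ) μ * W z ν)⁻¹ (dcurlAt W A A (z - e μ) μ ν) - Ad (W z μ * W (z + e μ) ν * (W (z + e ν) μ)⁻¹)⁻¹ (dcurlAt W A A z μ ν)‖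
      ≤ 64 * α₀ * α₁ + 1024 * x * α₀ ^ 2 := by
  -- the transport from `p − e_μ` to the frame of the fourth bond is `S · (plaquette) · u′(z)`, `S` the second transport
  have hT : (W (z - e μ) μ * W z ν)⁻¹
      = (W z μ * W (z + e μ) ν * (W (z + e ν) μ)⁻¹)⁻¹ * (hol W z (plaqWord μ ν) * (W (z - e μ) μ)⁻¹) := by
    rw [hol_plaqWord_eq]
    group
  rw [hT, Ad_mul, ← Ad_sub, norm_Ad_of_unitary ((unitaryUnits _).inv_mem
    ((unitaryUnits _).mul_mem ((unitaryUnits _).mul_mem (hW _ _) (hW _ _)) ((unitaryUnits _).inv_mem (hW _ _)))), Ad_mul]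
  have hcore := norm_dcurlAt_self_sub_Ad_shift_le hW hx hWx hA hA1 z μ ν μ
  have hh : hol W z (plaqWord μ ν) ∈ unitaryUnits (Matrix n n ℂ) := hol_mem_of (S := unitaryUnits (Matrix n n ℂ)) (fun x κ => hW x κ) z _
  have hhol := norm_Ad_hol_dcurlAt_sub_le hW hWx hA z hμν z μ ν
  -- `Ad_h (Ad_{u′} Q′) − Q = Ad_h (Ad_{u′} Q′ − Q) + (Ad_h Q − Q)`
  have hsplit : Ad (hol W z (plaqWord μ ν)) (Ad (W (z - e μ) μ)⁻¹ (dcurlAt W A A (z - e μ) μ ν)) - dcurlAt W A A z μ ν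
      = -(Ad (hol W z (plaqWord μ ν)) (dcurlAt W A A z μ ν - Ad (W (z - e μ) μ)⁻¹ (dcurlAt W A A (z - e μ) μ ν)))
        + (Ad (hol W z (plaqWord μ ν)) (dcurlAt W A A z μ ν) - dcurlAt W A A z μ ν) := by
    rw [Ad_sub]; abel
  rw [hsplit]
  calc _ ≤ ‖-(Ad (hol W z (plaqWord μ ν)) (dcurlAt W A A z μ ν - Ad (W (z - e μ) μ)⁻¹ (dcurlAt W A A (z - e μ) μ ν)))‖
        + ‖Ad (hol W z (plaqWord μ ν)) (dcurlAt W A A z μ ν) - dcurlAt W A A z μ ν‖ := norm_add_le _ _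
    _ ≤ (64 * α₀ * α₁ + 960 * x * α₀ ^ 2) + 64 * x * α₀ ^ 2 := by
        rw [norm_neg, norm_Ad_of_unitary hh]
        exact add_le_add hcore hhol
    _ = 64 * α₀ * α₁ + 1024 * x * α₀ ^ 2 := by ring

end

end Summit.QuantumFields.BalabanUV.T4Continuum.NE7CubicVertexCurved
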